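import Mathlib
import Summits.Ventures.PercRepro2.RootCutTheorem
import Summits.Ventures.PercRepro2.CutFarOA3States

/-!
# The marks `o` and `a₃` behind an unmarked cut vertex, II: the class, the sorting and the
two-gadget rule (blind cell PercRepro2, p3 g3, 2026-08-25; `proofs/P3-BRIDGE.md` §11.9 (c))

CLASS (`CutFarOA3`): an unmarked cut vertex `c` of the support separates `VH ∋ a₁, a₂, b` from
`VL ∋ o, a₃`.  On the support every copy has the state `gluedOB` (`st_eq_gluedOB`).  Sorting the
triples by the `o`-copy and the exact `a₃`-pattern (24 terms, `K3_eq_cutFarOA3`, `typedCount_eq_cutFarOA3_raw`),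
using the far side's copy symmetry (`far_swap12/13/23`) and the root-side ORBIT identities of
`CutFarOA3States.lean` (through `six_mul_typedCount`):
**`typedCount F z τ K₃ = (Pa · D + Pb · E) · (inert)`** with `D = #{o ∈ C_w(c), a₃ ∉ C_w(c)}`,
`E = #{o, a₃ ∈ C_w(c)}` (far counts, `D + E = #{o ∈ C_w(c)}`) and `Pa`, `Pb` the root-side sums over
the orbits `O₀` (the `o`-pendant type-1 gadget `c–o`) and `O₁′` (the gadget `c–u` type 1 with
`u–o, u–a₃` pinned; by orbit (d) equal to the `c–o` type-1 + `c–a₃` pinned gadget)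
(`typedCount_eq_cutFarOA3`), hence row 2′TRI on the class from row 2′TRI on the two gadget
instances (`typedCount_nonneg_of_cutFarOA3`).  Own work; standard axioms.
-/

namespace Summit.Ventures.PercRepro2

open UnionCluster

namespace CovForm

namespace RootBridge

open OneTyped TypedA3 Untouched TypedFactor Separated

section Support

open Classical

variable {V : Type*} {E : Type*} [Fintype E] [DecidableEq E]
variable (ends : E → Sym2 V) (o a₁ a₂ a₃ b c : V)

/-- **`o` and `a₃` behind an unmarked cut vertex `c`**: the support graph `z ∪ F` splits into a side
`VH ∋ a₁, a₂, b` and a side `VL ∋ o, a₃` meeting only in `c`, no typed edge inside both sides, `c`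
none of the five marks. -/
structure CutFarOA3 (VL VH : Set V) (F : Finset E) (z : Config E) : Prop where
  split : ∀ e, zF F z e = true → e ∈ within ends VL ∨ e ∈ within ends VH
  cap : ∀ t, t ∈ VL → t ∈ VH → t = c
  noloop : ∀ e ∈ F, ¬ (e ∈ within ends VL ∧ e ∈ within ends VH)
  cL : c ∈ VL
  cH : c ∈ VH
  a1H : a₁ ∈ VH
  a2H : a₂ ∈ VH
  bH : b ∈ VH
  oL : o ∈ VL
  a3L : a₃ ∈ VL
  a1c : a₁ ≠ c
  a2c : a₂ ≠ c
  bc : b ≠ c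
  oc : o ≠ c
  a3c : a₃ ≠ c

omit [Fintype E] in
/-- A configuration below `z ∪ F` has its open edges within a side. -/
lemma CutFarOA3.split_of_le {VL VH : Set V} {F : Finset E} {z : Config E}
    (h : CutFarOA3 ends o a₁ a₂ a₃ b c VL VH F z) {x : Config E} (hx : x ≤ zF F z) :
    ∀ e, x e = true → e ∈ within ends VL ∨ e ∈ within ends VH := fun e he =>
  h.split e (by have := hx e; rw [he] at this; exact Bool.eq_true_of_true_le this)

/-- The five root-side bits of a configuration, read inside `VH`. -/
noncomputable def rOA (VH : Set V) (x : Config E) : R5 :=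
  (decide (Conn ends (withinRestr ends VH x) a₂ a₁), decide (Conn ends (withinRestr ends VH x) a₁ c),
    decide (Conn ends (withinRestr ends VH x) a₂ c), decide (Conn ends (withinRestr ends VH x) a₁ b),
    decide (Conn ends (withinRestr ends VH x) a₂ b))

/-- A far bit `c ↔ v` of a configuration, read inside `VL`. -/
noncomputable def gOA (VL : Set V) (v : V) (x : Config E) : Bool :=
  decide (Conn ends (withinRestr ends VL x) c v)

omit [Fintype E] [DecidableEq E] in
/-- A transitivity implication as a Boolean clause. -/
lemma imp_clause' (A B C : Prop) [Decidable A] [Decidable B] [Decidable C] (h : A → B → C) :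
    (!(decide A && decide B) || decide C) = true := by
  by_cases hA : A <;> by_cases hB : B <;> simp [hA, hB]
  exact h hA hB

omit [Fintype E] [DecidableEq E] in
/-- **The root-side bits are valid**: transitivity of the connection relation. -/
lemma rOA_valid (VH : Set V) (x : Config E) : Valid5' (rOA ends a₁ a₂ b c VH x) = true := by
  unfold Valid5' rOA R5.q R5.a1 R5.a2 R5.lb R5.hb
  simp only [Bool.and_eq_true]
  refine ⟨⟨⟨⟨⟨?_, ?_⟩, ?_⟩, ?_⟩, ?_⟩, ?_⟩
  · exact imp_clause' _ _ _ fun h1 h2 => conn_trans h2 (conn_symm h1)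
  · exact imp_clause' _ _ _ fun h1 h2 => conn_trans h2 h1
  · exact imp_clause' _ _ _ fun h1 h2 => conn_trans (conn_symm h2) h1
  · exact imp_clause' _ _ _ fun h1 h2 => conn_trans h2 (conn_symm h1)
  · exact imp_clause' _ _ _ fun h1 h2 => conn_trans h2 h1
  · exact imp_clause' _ _ _ fun h1 h2 => conn_trans (conn_symm h2) h1

omit [Fintype E] in
/-- **The state of a copy of the support**. -/
theorem st_eq_gluedOB {VL VH : Set V} {F : Finset E} {z : Config E}
    (h : CutFarOA3 ends o a₁ a₂ a₃ b c VL VH F z) {x : Config E} (hx : ∀ e, e ∉ F → x e = z e) :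
    st ends o a₁ a₂ a₃ b x =
      gluedOB (rOA ends a₁ a₂ b c VH x) (gOA ends c VL o x) (gOA ends c VL a₃ x) := by
  have hsp := CutFarOA3.split_of_le ends o a₁ a₂ a₃ b c h (le_zF hx)
  have hsp' : ∀ e, x e = true → e ∈ within ends VH ∨ e ∈ within ends VL := fun e he =>
    (hsp e he).symm
  have hcap' : ∀ t, t ∈ VH → t ∈ VL → t = c := fun t h1 h2 => h.cap t h2 h1
  unfold st gluedOB rOA gOA R5.q R5.a1 R5.a2 R5.lb R5.hb
  have e1 := conn_side ends hsp' hcap' h.a2H h.a1H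
  have e2 := conn_cross ends hsp' hcap' ⟨h.cH, h.cL⟩ h.a1H h.oL h.oc
  have e3 := conn_cross ends hsp' hcap' ⟨h.cH, h.cL⟩ h.a2H h.oL h.oc
  have e4 := conn_side ends hsp' hcap' h.a1H h.bH
  have e5 := conn_side ends hsp' hcap' h.a2H h.bH
  have e6 := conn_cross ends hsp' hcap' ⟨h.cH, h.cL⟩ h.a1H h.a3L h.a3c
  have e7 := conn_cross ends hsp' hcap' ⟨h.cH, h.cL⟩ h.a2H h.a3L h.a3c
  rw [decide_eq_decide.mpr e1, decide_eq_decide.mpr e2, decide_eq_decide.mpr e3,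
    decide_eq_decide.mpr e4, decide_eq_decide.mpr e5, decide_eq_decide.mpr e6,
    decide_eq_decide.mpr e7]
  · simp only [Bool.decide_and]
  all_goals infer_instance

end Support

section Main

open Classical

variable {V : Type*} {E : Type*} [Fintype E] [DecidableEq E] {R : Type*} [Field R]
  [LinearOrder R] [IsStrictOrderedRing R]
variable (ends : E → Sym2 V) (o a₁ a₂ a₃ b c : V)

/-- A root-side pattern kernel, read on the root side. -/
noncomputable def hKOA (VH : Set V) (ox oy ow sx sy sw : Bool) :
    Config E → Config E → Config E → R :=
  fun x y w => ((patOB ox oy ow sx sy sw (rOA ends a₁ a₂ b c VH x) (rOA ends a₁ a₂ b c VH y)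
    (rOA ends a₁ a₂ b c VH w) : ℤ) : R)

/-- An `o`-selector: `indOB g` when the copy is the `o`-copy, else `1`. -/
def ofx (sel g : Bool) : ℤ := if sel then indOB g else 1

/-- The selector on the selected copy. -/
@[simp] lemma ofx_true (g : Bool) : ofx true g = indOB g := rfl
/-- The selector on an unselected copy. -/
@[simp] lemma ofx_false (g : Bool) : ofx false g = 1 := rfl

/-- A far-side pattern kernel: the `o`-bit of the selected copy times the exact `a₃`-pattern. -/
noncomputable def lKOA (VL : Set V) (ox oy ow sx sy sw : Bool) :
    Config E → Config E → Config E → R :=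
  fun x y w => ((ofx ox (gOA ends c VL o x) * ofx oy (gOA ends c VL o y) * ofx ow (gOA ends c VL o w) *
    exactOB sx sy sw (gOA ends c VL a₃ x) (gOA ends c VL a₃ y) (gOA ends c VL a₃ w) : ℤ) : R)

omit [Fintype E] [LinearOrder R] [IsStrictOrderedRing R] in
/-- The root-side bits only see the root-side typed edges. -/
lemma rOA_restr (VH : Set V) {F : Finset E} {z x : Config E} (hx : ∀ e, e ∉ F → x e = z e) :
    rOA ends a₁ a₂ b c VH (restr (sideF ends VH F) z x) = rOA ends a₁ a₂ b c VH x := by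
  unfold rOA
  rw [withinRestr_restr_eq ends VH hx]

omit [Fintype E] [LinearOrder R] [IsStrictOrderedRing R] in
/-- The far-side bits only see the far-side typed edges. -/
lemma gOA_restr (VL : Set V) (v : V) {F : Finset E} {z x : Config E}
    (hx : ∀ e, e ∉ F → x e = z e) :
    gOA ends c VL v (restr (sideF ends VL F) z x) = gOA ends c VL v x := by
  unfold gOA
  rw [withinRestr_restr_eq ends VL hx]

omit [Fintype E] [LinearOrder R] [IsStrictOrderedRing R] in
/-- **`K₃` on the support**: the 24-term form (`o`-copy × exact `a₃`-pattern). -/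
theorem K3_eq_cutFarOA3 {VL VH : Set V} {F : Finset E} {z : Config E}
    (h : CutFarOA3 ends o a₁ a₂ a₃ b c VL VH F z) {x y w : Config E}
    (hx : ∀ e, e ∉ F → x e = z e) (hy : ∀ e, e ∉ F → y e = z e) (hw : ∀ e, e ∉ F → w e = z e) :
    (K3 ends o a₁ a₂ a₃ b x y w : R) =
      lKOA ends o a₃ c VL true false false false false false (restr (sideF ends VL F) z x)
          (restr (sideF ends VL F) z y) (restr (sideF ends VL F) z w) *
        hKOA ends a₁ a₂ b c VH true false false false false false (restr (sideF ends VH F) z x)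
          (restr (sideF ends VH F) z y) (restr (sideF ends VH F) z w) +
      lKOA ends o a₃ c VL true false false true false false (restr (sideF ends VL F) z x)
          (restr (sideF ends VL F) z y) (restr (sideF ends VL F) z w) *
        hKOA ends a₁ a₂ b c VH true false false true false false (restr (sideF ends VH F) z x)
          (restr (sideF ends VH F) z y) (restr (sideF ends VH F) z w) +
      lKOA ends o a₃ c VL true false false false true false (restr (sideF ends VL F) z x)
          (restr (sideF ends VL F) z y) (restr (sideF ends VL F) z w) *
        hKOA ends a₁ a₂ b c VH true false false false true false (restr (sideF ends VH F) z x)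
          (restr (sideF ends VH F) z y) (restr (sideF ends VH F) z w) +
      lKOA ends o a₃ c VL true false false false false true (restr (sideF ends VL F) z x)
          (restr (sideF ends VL F) z y) (restr (sideF ends VL F) z w) *
        hKOA ends a₁ a₂ b c VH true false false false false true (restr (sideF ends VH F) z x)
          (restr (sideF ends VH F) z y) (restr (sideF ends VH F) z w) +
      lKOA ends o a₃ c VL true false false true true false (restr (sideF ends VL F) z x)
          (restr (sideF ends VL F) z y) (restr (sideF ends VL F) z w) *
        hKOA ends a₁ a₂ b c VH true false false true true false (restr (sideF ends VH F) z x)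
          (restr (sideF ends VH F) z y) (restr (sideF ends VH F) z w) +
      lKOA ends o a₃ c VL true false false true false true (restr (sideF ends VL F) z x)
          (restr (sideF ends VL F) z y) (restr (sideF ends VL F) z w) *
        hKOA ends a₁ a₂ b c VH true false false true false true (restr (sideF ends VH F) z x)
          (restr (sideF ends VH F) z y) (restr (sideF ends VH F) z w) +
      lKOA ends o a₃ c VL true false false false true true (restr (sideF ends VL F) z x)
          (restr (sideF ends VL F) z y) (restr (sideF ends VL F) z w) *
        hKOA ends a₁ a₂ b c VH true false false false true true (restr (sideF ends VH F) z x)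
          (restr (sideF ends VH F) z y) (restr (sideF ends VH F) z w) +
      lKOA ends o a₃ c VL true false false true true true (restr (sideF ends VL F) z x)
          (restr (sideF ends VL F) z y) (restr (sideF ends VL F) z w) *
        hKOA ends a₁ a₂ b c VH true false false true true true (restr (sideF ends VH F) z x)
          (restr (sideF ends VH F) z y) (restr (sideF ends VH F) z w) +
      lKOA ends o a₃ c VL false true false false false false (restr (sideF ends VL F) z x)
          (restr (sideF ends VL F) z y) (restr (sideF ends VL F) z w) *
        hKOA ends a₁ a₂ b c VH false true false false false false (restr (sideF ends VH F) z x)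
          (restr (sideF ends VH F) z y) (restr (sideF ends VH F) z w) +
      lKOA ends o a₃ c VL false true false true false false (restr (sideF ends VL F) z x)
          (restr (sideF ends VL F) z y) (restr (sideF ends VL F) z w) *
        hKOA ends a₁ a₂ b c VH false true false true false false (restr (sideF ends VH F) z x)
          (restr (sideF ends VH F) z y) (restr (sideF ends VH F) z w) +
      lKOA ends o a₃ c VL false true false false true false (restr (sideF ends VL F) z x)
          (restr (sideF ends VL F) z y) (restr (sideF ends VL F) z w) *
        hKOA ends a₁ a₂ b c VH false true false false true false (restr (sideF ends VH F) z x)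
          (restr (sideF ends VH F) z y) (restr (sideF ends VH F) z w) +
      lKOA ends o a₃ c VL false true false false false true (restr (sideF ends VL F) z x)
          (restr (sideF ends VL F) z y) (restr (sideF ends VL F) z w) *
        hKOA ends a₁ a₂ b c VH false true false false false true (restr (sideF ends VH F) z x)
          (restr (sideF ends VH F) z y) (restr (sideF ends VH F) z w) +
      lKOA ends o a₃ c VL false true false true true false (restr (sideF ends VL F) z x)
          (restr (sideF ends VL F) z y) (restr (sideF ends VL F) z w) *
        hKOA ends a₁ a₂ b c VH false true false true true false (restr (sideF ends VH F) z x)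
          (restr (sideF ends VH F) z y) (restr (sideF ends VH F) z w) +
      lKOA ends o a₃ c VL false true false true false true (restr (sideF ends VL F) z x)
          (restr (sideF ends VL F) z y) (restr (sideF ends VL F) z w) *
        hKOA ends a₁ a₂ b c VH false true false true false true (restr (sideF ends VH F) z x)
          (restr (sideF ends VH F) z y) (restr (sideF ends VH F) z w) +
      lKOA ends o a₃ c VL false true false false true true (restr (sideF ends VL F) z x)
          (restr (sideF ends VL F) z y) (restr (sideF ends VL F) z w) *
        hKOA ends a₁ a₂ b c VH false true false false true true (restr (sideF ends VH F) z x)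
          (restr (sideF ends VH F) z y) (restr (sideF ends VH F) z w) +
      lKOA ends o a₃ c VL false true false true true true (restr (sideF ends VL F) z x)
          (restr (sideF ends VL F) z y) (restr (sideF ends VL F) z w) *
        hKOA ends a₁ a₂ b c VH false true false true true true (restr (sideF ends VH F) z x)
          (restr (sideF ends VH F) z y) (restr (sideF ends VH F) z w) +
      lKOA ends o a₃ c VL false false true false false false (restr (sideF ends VL F) z x)
          (restr (sideF ends VL F) z y) (restr (sideF ends VL F) z w) *
        hKOA ends a₁ a₂ b c VH false false true false false false (restr (sideF ends VH F) z x)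
          (restr (sideF ends VH F) z y) (restr (sideF ends VH F) z w) +
      lKOA ends o a₃ c VL false false true true false false (restr (sideF ends VL F) z x)
          (restr (sideF ends VL F) z y) (restr (sideF ends VL F) z w) *
        hKOA ends a₁ a₂ b c VH false false true true false false (restr (sideF ends VH F) z x)
          (restr (sideF ends VH F) z y) (restr (sideF ends VH F) z w) +
      lKOA ends o a₃ c VL false false true false true false (restr (sideF ends VL F) z x)
          (restr (sideF ends VL F) z y) (restr (sideF ends VL F) z w) *
        hKOA ends a₁ a₂ b c VH false false true false true false (restr (sideF ends VH F) z x)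
          (restr (sideF ends VH F) z y) (restr (sideF ends VH F) z w) +
      lKOA ends o a₃ c VL false false true false false true (restr (sideF ends VL F) z x)
          (restr (sideF ends VL F) z y) (restr (sideF ends VL F) z w) *
        hKOA ends a₁ a₂ b c VH false false true false false true (restr (sideF ends VH F) z x)
          (restr (sideF ends VH F) z y) (restr (sideF ends VH F) z w) +
      lKOA ends o a₃ c VL false false true true true false (restr (sideF ends VL F) z x)
          (restr (sideF ends VL F) z y) (restr (sideF ends VL F) z w) *
        hKOA ends a₁ a₂ b c VH false false true true true false (restr (sideF ends VH F) z x)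
          (restr (sideF ends VH F) z y) (restr (sideF ends VH F) z w) +
      lKOA ends o a₃ c VL false false true true false true (restr (sideF ends VL F) z x)
          (restr (sideF ends VL F) z y) (restr (sideF ends VL F) z w) *
        hKOA ends a₁ a₂ b c VH false false true true false true (restr (sideF ends VH F) z x)
          (restr (sideF ends VH F) z y) (restr (sideF ends VH F) z w) +
      lKOA ends o a₃ c VL false false true false true true (restr (sideF ends VL F) z x)
          (restr (sideF ends VL F) z y) (restr (sideF ends VL F) z w) *
        hKOA ends a₁ a₂ b c VH false false true false true true (restr (sideF ends VH F) z x)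
          (restr (sideF ends VH F) z y) (restr (sideF ends VH F) z w) +
      lKOA ends o a₃ c VL false false true true true true (restr (sideF ends VL F) z x)
          (restr (sideF ends VL F) z y) (restr (sideF ends VL F) z w) *
        hKOA ends a₁ a₂ b c VH false false true true true true (restr (sideF ends VH F) z x)
          (restr (sideF ends VH F) z y) (restr (sideF ends VH F) z w) := by
  rw [K3_eq_KB, st_eq_gluedOB ends o a₁ a₂ a₃ b c h hx, st_eq_gluedOB ends o a₁ a₂ a₃ b c h hy,
    st_eq_gluedOB ends o a₁ a₂ a₃ b c h hw]
  have hpat : KB (gluedOB (rOA ends a₁ a₂ b c VH x) (gOA ends c VL o x) (gOA ends c VL a₃ x))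
      (gluedOB (rOA ends a₁ a₂ b c VH y) (gOA ends c VL o y) (gOA ends c VL a₃ y))
      (gluedOB (rOA ends a₁ a₂ b c VH w) (gOA ends c VL o w) (gOA ends c VL a₃ w)) =
      patOB (gOA ends c VL o x) (gOA ends c VL o y) (gOA ends c VL o w)
        (gOA ends c VL a₃ x) (gOA ends c VL a₃ y) (gOA ends c VL a₃ w)
        (rOA ends a₁ a₂ b c VH x) (rOA ends a₁ a₂ b c VH y) (rOA ends a₁ a₂ b c VH w) := rfl
  rw [hpat, KB_gluedOB_lin (gOA ends c VL o x) (gOA ends c VL o y) (gOA ends c VL o w)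
    (gOA ends c VL a₃ x) (gOA ends c VL a₃ y) (gOA ends c VL a₃ w)
    (rOA ends a₁ a₂ b c VH x) (rOA ends a₁ a₂ b c VH y) (rOA ends a₁ a₂ b c VH w)]
  rw [    KB_gluedOB_pat true false false (gOA ends c VL a₃ x) (gOA ends c VL a₃ y) (gOA ends c VL a₃ w)
      (rOA ends a₁ a₂ b c VH x) (rOA ends a₁ a₂ b c VH y) (rOA ends a₁ a₂ b c VH w),
    KB_gluedOB_pat false true false (gOA ends c VL a₃ x) (gOA ends c VL a₃ y) (gOA ends c VL a₃ w)
      (rOA ends a₁ a₂ b c VH x) (rOA ends a₁ a₂ b c VH y) (rOA ends a₁ a₂ b c VH w),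
    KB_gluedOB_pat false false true (gOA ends c VL a₃ x) (gOA ends c VL a₃ y) (gOA ends c VL a₃ w)
      (rOA ends a₁ a₂ b c VH x) (rOA ends a₁ a₂ b c VH y) (rOA ends a₁ a₂ b c VH w)]
  unfold hKOA lKOA
  simp only [rOA_restr ends a₁ a₂ b c VH hx, rOA_restr ends a₁ a₂ b c VH hy,
    rOA_restr ends a₁ a₂ b c VH hw, gOA_restr ends c VL o hx, gOA_restr ends c VL o hy,
    gOA_restr ends c VL o hw, gOA_restr ends c VL a₃ hx, gOA_restr ends c VL a₃ hy,
    gOA_restr ends c VL a₃ hw, ofx_true, ofx_false]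
  push_cast
  ring

end Main

end RootBridge

end CovForm

end Summit.Ventures.PercRepro2
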